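import Summits.CriticalPhenomena.SAWScalingLimit.Theses.SAWPoissonBanks
import Summits.CriticalPhenomena.SAWScalingLimit.Theorems.SAWLoopFugacityFlowSLEAvoidanceValue
import Literature.Probability.RandomPlanarGeometry.SLEExistenceNeEightHolds
import Literature.Probability.RandomPlanarGeometry.SAWSideProbability
import Literature.Probability.RandomPlanarGeometry.LocalMartingaleProofs

/-!
# The open content of `SAWPoissonBanks.MutualAvoidanceLaw` (stmt-CriticalPhenomena-4779): it
contains the one-sided hull-avoidance law with exponent `5/8`

Route `SAWPoissonBanks` of `CriticalPhenomena/SAWScalingLimit`, support item `MutualAvoidanceLaw`.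
Taking the two hull complements EQUAL (`F₁ = F₂ = D'`) in `MutualAvoidanceLaw`, the log-covariance
ratio is `1 / q_δ(E_{D'})` (`E_{D'} = {range ⊆ cl D'}`) and its asserted limit is `1 / μ(E_{D'})`,
`μ` the chordal SLE_{8/3} law of `D`; since `μ(E_{D'}) = Φ'_A(0)^{5/8} > 0` ([LSW] Thm. 6.1
transposed, `SLEAvoidanceValue_proof`; `Φ'_A(0) ∈ (0, 1]`, [LSW] (2.4)), the item yields

  `P_δ(range γ_δ ⊆ cl D') → Φ'_A(0)^{5/8}` as `δ → 0⁺`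

for EVERY Dobrushin domain, EVERY endpoint approximation and EVERY hull subdomain `D'` hanging
off one boundary arc — Lawler–Schramm–Werner's restriction-exponent prediction for the planar
SAW (LSW 2004, §4.1, the "restriction formula" consequence of Prediction 1), i.e. the sibling
crux `SAWLoopFugacityFlow.AvoidanceLimit` (stmt-CriticalPhenomena-10649, typed there for all hull
subdomains) restricted to one-sided hulls. This file proves that implication verbatim in the
typed format of `AvoidanceLimit` plus the one extra hypothesis `∃ j, D.arc j ⊆ frontier D'`.
Together with `MutualAvoidanceLaw_of_SAWScalingLimit` (file
`SAWPoissonBanksMutualAvoidanceLawOfScalingLimit`) this brackets the item between the open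
one-sided avoidance law and the sub-problem `SAWScalingLimit`.

## References

* G. F. Lawler, O. Schramm, W. Werner, *Conformal restriction: the chordal case*, J. Amer. Math.
  Soc. 16 (2003), Thm. 6.1 and §2 (2.4).
* G. F. Lawler, O. Schramm, W. Werner, *On the scaling limit of planar self-avoiding walk*, Proc.
  Sympos. Pure Math. 72 (2004), §3.4.2 and §4.1.
-/

noncomputable section

open MeasureTheory Filter Topology Set
open scoped NNReal ENNReal
open UpperHalfPlane (upperHalfPlaneSet)
open Literature.Probability Literature.Probability.LatticeModels
open Literature.Probability.RandomPlanarGeometry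

namespace Summit.CriticalPhenomena.SAWScalingLimit.Theorems

/-- **`MutualAvoidanceLaw` implies the one-sided hull-avoidance law with exponent `5/8`.** Under
`MutualAvoidanceLaw`, for every Dobrushin domain `(D; a, b)`, endpoint approximation, and hull
subdomain `D' ⊆ D` (same marked points, agreeing with `D` near them) which keeps one whole
boundary arc of `D` on its frontier, and for every chordal uniformizing map `φ` with restriction
data `(Φ, d = Φ'_A(0))` of the pulled-back hull `A = cl (ℍ ∖ φ⁻¹ D')`, the critical-SAW
probability `P_δ(range γ_δ ⊆ cl D')` tends to `d ^ (5/8)` as `δ → 0⁺` — the statement of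
`SAWLoopFugacityFlow.AvoidanceLimit` for one-sided hulls. Proof: specialise `MutualAvoidanceLaw`
to `F₁ = F₂ = D'`; the ratio is `1 / q_δ` with limit `1 / μ(E_{D'})`, and
`μ(E_{D'}) = d^{5/8} > 0` (`SLEAvoidanceValue_proof`, [LSW] Thm. 6.1; `d > 0`, [LSW] (2.4)), so
`q_δ → d^{5/8}` by continuity of inversion.
[cite: LawlerSchrammWerner2003Restriction, Thm. 6.1 (p. 23) and (2.4) (p. 7)] -/
theorem oneSidedAvoidanceLimit_of_MutualAvoidanceLaw
    (h : Summit.CriticalPhenomena.SAWScalingLimit.Theses.SAWPoissonBanks.MutualAvoidanceLaw)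
    (D D' : DobrushinDomain) (a b : ℝ → Site 2) (happ : SAW.IsEndpointApprox D a b)
    (hsub : D'.carrier ⊆ D.carrier) (h0 : D'.pt 0 = D.pt 0) (h1 : D'.pt 1 = D.pt 1)
    (hj : ∃ j : Fin 2, D.arc j ⊆ frontier D'.carrier)
    (hε : ∃ ε : ℝ, 0 < ε ∧
      D'.carrier ∩ Metric.ball (D.pt 0) ε = D.carrier ∩ Metric.ball (D.pt 0) ε ∧
      D'.carrier ∩ Metric.ball (D.pt 1) ε = D.carrier ∩ Metric.ball (D.pt 1) ε)
    (φ : ConformalEquiv upperHalfPlaneSet D.carrier) (hφ : D.IsChordalUniformizing φ)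
    (A : Set ℂ)
    (hA : A = closure (upperHalfPlaneSet \ {z | z ∈ upperHalfPlaneSet ∧ φ z ∈ D'.carrier}))
    (Φ : ConformalEquiv (upperHalfPlaneSet \ A) upperHalfPlaneSet) (d : ℝ)
    (hΦ : IsRestrictionMap A Φ) (hd : HasRestrictionDeriv A Φ d) :
    Tendsto (fun δ ↦ ((SAW.law D.carrier δ (a δ) (b δ)).map (fun γ ↦ γ.curve))
      (CurveClass.rangeSubset (closure D'.carrier))) (𝓝[>] (0 : ℝ))
      (𝓝 (ENNReal.ofReal (d ^ ((5 : ℝ) / 8)))) := by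
  subst hA
  change ConformalEquiv (upperHalfPlaneSet \ φ.pullbackHull D') upperHalfPlaneSet at Φ
  change IsRestrictionMap (φ.pullbackHull D') Φ at hΦ
  change HasRestrictionDeriv (φ.pullbackHull D') Φ d at hd
  haveI : Fact Process.isProjectiveLimit_preWienerMeasure :=
    ⟨isProjectiveLimit_preWienerMeasure_holds⟩
  -- the SLE_{8/3} law of `D`
  obtain ⟨Γ, hΓ⟩ := exists_isSLECurve_eightThirds D
  have hμ : IsSLELaw ((8 : ℝ≥0) / 3) D (Process.preWienerMeasure.map Γ) := hΓ.isSLELaw_map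
  -- the item, specialised to `F₁ = F₂ = D'`
  obtain ⟨j, hj⟩ := hj
  have hr := h D a b happ j D' D' ⟨hsub, h0, h1, hj, hε⟩ ⟨hsub, h0, h1, hj, hε⟩ _ hμ
  set μ : Measure (CurveClass ℂ) := Process.preWienerMeasure.map Γ with hμdef
  set E : Set (CurveClass ℂ) := CurveClass.rangeSubset (closure D'.carrier) with hE
  simp only [Set.inter_self] at hr
  -- the SLE value `μ E = d ^ (5/8)`, and `d > 0`
  have hval : μ E = ENNReal.ofReal (d ^ ((5 : ℝ) / 8)) :=
    SLEAvoidanceValue_proof D D' μ hμ hsub h0 h1 hε φ hφ _ rfl Φ d hΦ hd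
  have hdpos : 0 < d := by
    have hHull : D.IsHullSubdomain D' :=
      IsingBoundaryRatio.Negative.isHullSubdomain_of_conds hsub h0 h1 hε
    have hstar : IsStarHull (φ.pullbackHull D') :=
      IsStarHull.pullbackHull JordanDomain.isSimplyConnected_holds hφ hHull
    obtain ⟨d', hd'0, -, hd'⟩ := IsStarHull.exists_hasRestrictionDeriv_holds hstar hΦ
    rw [HasRestrictionDeriv.unique hstar hd hd']
    exact hd'0
  have hm : (μ E).toReal = d ^ ((5 : ℝ) / 8) := by
    rw [hval, ENNReal.toReal_ofReal (Real.rpow_nonneg hdpos.le _)]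
  have hmpos : 0 < (μ E).toReal := hm ▸ Real.rpow_pos_of_pos hdpos _
  have hL : (μ E).toReal / ((μ E).toReal * (μ E).toReal) = ((μ E).toReal)⁻¹ := by
    field_simp
  rw [hL] at hr
  -- invert: `q_δ = (ratio_δ)⁻¹` eventually, and `ratio_δ → (μ E)⁻¹`
  have hqt : Tendsto
      (fun δ ↦ (((SAW.law D.carrier δ (a δ) (b δ)).map (fun γ ↦ γ.curve)) E).toReal)
      (𝓝[>] (0 : ℝ)) (𝓝 (μ E).toReal) := by
    have hinv := hr.inv₀ (inv_ne_zero hmpos.ne')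
    rw [inv_inv] at hinv
    refine hinv.congr' ?_
    filter_upwards [hr.eventually_ne (inv_ne_zero hmpos.ne')] with δ hδ
    have hx : (((SAW.law D.carrier δ (a δ) (b δ)).map (fun γ ↦ γ.curve)) E).toReal ≠ 0 := by
      intro hx
      rw [hx, zero_div] at hδ
      exact hδ rfl
    field_simp
  -- back to `ℝ≥0∞`
  have hfin : ∀ δ, ((SAW.law D.carrier δ (a δ) (b δ)).map (fun γ ↦ γ.curve)) E ≠ ⊤ := fun δ ↦ by
    rw [Measure.map_apply (SAW.DomainSAW.measurable_of_top _)
      (CurveClass.measurableSet_rangeSubset isClosed_closure)]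
    exact ((SAW.law_apply_le_one _ _ _ _ _).trans_lt ENNReal.one_lt_top).ne
  have key := ENNReal.tendsto_ofReal hqt
  rw [hm] at key
  exact key.congr' (Eventually.of_forall fun δ ↦ ENNReal.ofReal_toReal (hfin δ))

end Summit.CriticalPhenomena.SAWScalingLimit.Theorems
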